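import Mathlib

/-!
# Elementary symmetric polynomials at `0/1` points over `𝔽₂`

Helper for the Möbius-ladder `DigitPolyUniformity` line (symmetric digit polynomials):
evaluating the elementary symmetric polynomial `e_k ∈ 𝔽₂[X₀,…,X_{n-1}]` at the indicator
vector of a Boolean string `b` with `w` ones gives the binomial coefficient `C(w, k) mod 2`,
because `e_k = ∑_{|t| = k} ∏_{i ∈ t} X_i` and a `k`-subset `t` contributes `1` exactly when it
lies inside the support of `b`.
-/

set_option linter.dupNamespace false -- D-0017: single-problem summit ⇒ QuantumAdvantage.QuantumAdvantage by design

namespace Summit.QuantumAdvantage.QuantumAdvantage.Theorems.MobiusLadder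

namespace EsymmIndicator

/-- The `k`-subsets of `Fin n` all of whose elements satisfy `p` are exactly the `k`-subsets of
`{i | p i}`. [folklore] -/
theorem filter_powersetCard_univ_forall (n k : ℕ) (p : Fin n → Prop) [DecidablePred p] :
    (Finset.powersetCard k (Finset.univ : Finset (Fin n))).filter (fun t => ∀ i ∈ t, p i) =
      Finset.powersetCard k (Finset.univ.filter p) := by
  ext t
  simp only [Finset.mem_filter, Finset.mem_powersetCard, Finset.subset_iff, Finset.mem_univ,
    implies_true, true_and]
  exact and_comm

/-- A product of `0/1` indicators over `t` is the indicator of "every `i ∈ t` satisfies `p`"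
(stated for arbitrary `Decidable` instances on both sides). [folklore] -/
theorem prod_ite_one_zero_eq {α M : Type*} [CommMonoidWithZero M] (t : Finset α) (p : α → Prop)
    {_ : DecidablePred p} {_ : Decidable (∀ i ∈ t, p i)} :
    ∏ i ∈ t, (if p i then (1 : M) else 0) = if ∀ i ∈ t, p i then 1 else 0 := by
  by_cases h : ∀ i ∈ t, p i
  · rw [if_pos h]
    exact Finset.prod_eq_one fun i hi => if_pos (h i hi)
  · rw [if_neg h]
    push Not at h
    obtain ⟨i, hi, hpi⟩ := h
    exact Finset.prod_eq_zero hi (if_neg hpi)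

end EsymmIndicator

/-- `e_k` evaluated over `ZMod 2` at the `0/1` indicator vector of `b : Fin n → Bool` equals
`C(w, k)`, where `w = #{i | b i = true}` is the number of ones of `b`. [folklore] -/
theorem eval_esymm_indicator : ∀ (n k : ℕ) (b : Fin n → Bool),
    MvPolynomial.eval (fun i : Fin n => if b i then (1 : ZMod 2) else 0)
      (MvPolynomial.esymm (Fin n) (ZMod 2) k) =
      (((Finset.univ.filter fun i : Fin n => b i = true).card.choose k : ℕ) : ZMod 2) := by
  intro n k b
  rw [MvPolynomial.esymm, map_sum, ← Finset.card_powersetCard,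
    ← EsymmIndicator.filter_powersetCard_univ_forall, Finset.natCast_card_filter]
  refine Finset.sum_congr rfl fun t _ => ?_
  rw [map_prod]
  simp only [MvPolynomial.eval_X]
  exact EsymmIndicator.prod_ite_one_zero_eq t _

end Summit.QuantumAdvantage.QuantumAdvantage.Theorems.MobiusLadder
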